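import Literature.Analysis.FluidPDE.TsaiProfileEndgame
import Literature.Analysis.FluidPDE.TsaiGrowthLemmasProofs
import Literature.Analysis.FluidPDE.TsaiLemma32Holds
import HarnessLib

/-!
# Tsai 1998, Theorem 1, the case `q = ∞`: bounded Leray profiles are constant

T.-P. Tsai, *On Leray's self-similar solutions of the Navier–Stokes equations satisfying local
energy estimates*, Arch. Rational Mech. Anal. 143 (1998) 29–51, **Theorem 1** (p. 31): "If a weak
solution `U` of (1.3) belongs to `L^q(ℝ³)` for some `q ∈ (3, ∞]`, then it must be constant (and
hence identically zero if `q < ∞`)."  The tree's named fact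
`Literature.Analysis.FluidPDE.tsai_selfsimilar` (`FluidPDE/SelfSimilarLiouville`, discharged in
`TsaiSelfSimilarHolds`) renders the case `3 < q < ∞`; this file adds the endpoint **`q = ∞`**:
a *bounded* profile `(U, P)` of Leray's system `−νΔU + aU + a(y·∇)U + (U·∇)U + ∇P = 0`,
`div U = 0` (`IsLerayProfile ν a U P`, `ν > 0`, `a > 0`) has constant velocity `U ≡ c`
(`tsai_selfsimilar_bounded`, requested by route NavierStokes/`SymmetryModuliCount`, item
`SymmetricLiouville`, sub-case `α = 0`), and PROVES it (`tsai_selfsimilar_bounded_holds`).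

## The proof (Tsai 1998, §5, p. 48, verbatim route for `q = ∞`)

"Lemmas 3.2 and 3.3 … give us the growth estimates `U(y) = o(|y|)`, `Π(y) = O(|y|^N)` … Lemma 5.1
then implies that `Π` is constant … we get `−νΔUᵢ = 0` for each `i`. Since `U ∈ L^q(ℝ³)` … the
usual Liouville theorem implies that the `Uᵢ` are" constant.  For `q = ∞`: `U` bounded gives
`U(y) = o(|y|)` for free (`|U(y)| ≤ M ≤ (a/2)|y|` for `|y| ≥ 2M/a`; Lemma 3.3 is not needed);
Lemma 3.2 (`tsai1998_lemma32`, stated for `3 ≤ q ≤ ∞` and discharged: `tsai1998_lemma32_holds`)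
gives `P(y) = O(|y|^N)` from `U ∈ L^∞`; regularity `U ∈ C^∞` is `tsai1998_profile_smooth_holds`
and then `P ∈ C²` (`IsLerayProfile.contDiff_two_pressure`); the head pressure
`Π = ½|U|² + P + a y·U` is polynomially bounded (`abs_headPressure_le`) and `L`-subharmonic
((1.7), `IsLerayProfile.driftOp_headPressure_nonneg_of_contDiff`), hence constant by Lemma 5.1
(`isConst_of_driftOp_nonneg_of_poly`), hence `ΔU ≡ 0`
(`IsLerayProfile.laplacian_eq_zero_of_headPressure_const_of_contDiff`) — all proved in
`TsaiProfileEndgame`/`TsaiMaximumPrinciple`.  The last step is **Liouville's theorem for bounded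
harmonic functions** on a finite-dimensional inner product space, proved here
(`isConst_of_harmonic_bounded`, `isConst_of_harmonic_bounded_inner`) from the mean-value formula
for the gradient against the unit-mass bumps `χ_R` of `HarmonicProbe`
(`fderiv_harmonic_eq_integral_probeBump`: `Dη(y)a = ∫ ∂ₐχ_R(z) η(y − z) dz`,
`‖Dχ_R‖ ≤ C (m R^{d+1})⁻¹`, `supp χ_R ⊆ B̄(0, 2R)`): `|Dη(y)a| ≤ K‖a‖ sup|η| / R → 0`
(Gilbarg–Trudinger, Thm 2.10 / (2.31) with `R → ∞`).

No new unproved facts; the only new definition is the named statement `tsai_selfsimilar_bounded`,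
discharged in this file.

## References

* [Tsai1998] T.-P. Tsai, Arch. Rational Mech. Anal. 143 (1998) 29–51: Theorem 1 (p. 31), Lemma 3.2
  (p. 39), Lemma 5.1 and the proofs of Theorems 1 and 2 (§5, pp. 47–49).
* [GilbargTrudinger2001] D. Gilbarg, N. S. Trudinger, *Elliptic partial differential equations
  of second order*, Thm 2.1 (mean value), Thm 2.10 and (2.31) (interior derivative estimates;
  Liouville).
* B. Pineau, V. Vicol (2026), arXiv:2607.09619, p. 2 (quoting Tsai's Theorem 1 for
  `p ∈ (3, ∞]`).
-/

noncomputable section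

open MeasureTheory Set Function Filter Topology InnerProductSpace Metric
open scoped RealInnerProductSpace Laplacian ContDiff NNReal ENNReal

namespace Literature.Analysis.FluidPDE

/-! ## Liouville's theorem for bounded harmonic functions -/

section BoundedLiouville

variable {E : Type*} [NormedAddCommGroup E] [InnerProductSpace ℝ E] [FiniteDimensional ℝ E]
  [MeasurableSpace E] [BorelSpace E]

/-- **Interior gradient estimate at scale `R` for a bounded harmonic function**
(Gilbarg–Trudinger (2.31) with `d(y) = R` arbitrary): if `η` is harmonic on `E` with `|η| ≤ B`
and `‖Dθ‖ ≤ C_θ` bounds the gradient of the base bump `θ` of `HarmonicProbe`, then for every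
`R > 0`, `|Dη(y) a| ≤ m⁻¹ C_θ B ‖a‖ 2^d |B̄₁| · R⁻¹` (`m = ∫ θ`, `d = dim E`): the mean-value
formula `Dη(y) a = ∫ ∂ₐχ_R(z) η(y − z) dz` with `‖Dχ_R‖ ≤ (m R^d)⁻¹ R⁻¹ C_θ` on
`supp χ_R ⊆ B̄(0, 2R)`.
[cite: GilbargTrudinger2001, Thm 2.10] -/
theorem abs_fderiv_apply_le_of_harmonic_bounded {η : E → ℝ} (hη : HarmonicOnNhd η univ)
    {B : ℝ} (hB : ∀ x, |η x| ≤ B) {Cθ : ℝ} (hCθ : ∀ x : E, ‖fderiv ℝ baseBump x‖ ≤ Cθ)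
    {R : ℝ} (hR : 0 < R) (y a : E) :
    |fderiv ℝ η y a| ≤ (baseBumpMass E)⁻¹ * Cθ * B * ‖a‖ *
      ((2 : ℝ) ^ Module.finrank ℝ E * (volume (closedBall (0 : E) 1)).toReal) * R⁻¹ := by
  set d := Module.finrank ℝ E with hd
  set m := baseBumpMass E with hm
  have hm0 : 0 < m := baseBumpMass_pos
  have hB0 : 0 ≤ B := (abs_nonneg _).trans (hB 0)
  have hC0 : 0 ≤ Cθ := (norm_nonneg _).trans (hCθ 0)
  -- the uniform bound on `Dχ_R`
  set c := (m * R ^ d)⁻¹ * R⁻¹ * Cθ with hc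
  have hc0 : 0 ≤ c := by positivity
  have hDχ : ∀ z : E, ‖fderiv ℝ (probeBump R) z‖ ≤ c := fun z => norm_fderiv_probeBump_le hR hCθ z
  rw [fderiv_harmonic_eq_integral_probeBump hη hR y a]
  -- domination by the indicator of the closed ball of radius `2R`
  set g : E → ℝ := fun z => (closedBall (0 : E) (2 * R)).indicator (fun _ => c * ‖a‖ * B) z
    with hg
  have hdom : ∀ z, ‖fderiv ℝ (probeBump R) z a * η (y - z)‖ ≤ g z := by
    intro z
    simp only [hg]
    by_cases hz : z ∈ closedBall (0 : E) (2 * R)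
    · rw [indicator_of_mem hz, norm_mul, Real.norm_eq_abs, Real.norm_eq_abs]
      have h1 : |fderiv ℝ (probeBump R) z a| ≤ c * ‖a‖ := by
        rw [← Real.norm_eq_abs]
        exact (ContinuousLinearMap.le_opNorm _ _).trans
          (mul_le_mul_of_nonneg_right (hDχ z) (norm_nonneg _))
      exact mul_le_mul h1 (hB _) (abs_nonneg _) (by positivity)
    · rw [indicator_of_notMem hz]
      have hz' : z ∉ tsupport (probeBump (E := E) R) := fun h => hz (tsupport_probeBump_subset hR h)
      rw [fderiv_of_notMem_tsupport ℝ hz']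
      simp
  have hgi : Integrable g := by
    rw [hg, integrable_indicator_iff measurableSet_closedBall]
    exact integrableOn_const (isCompact_closedBall _ _).measure_lt_top.ne
  have hint := norm_integral_le_of_norm_le hgi (Eventually.of_forall hdom)
  rw [Real.norm_eq_abs] at hint
  refine hint.trans_eq ?_
  -- evaluate `∫ g`
  rw [hg, integral_indicator measurableSet_closedBall, setIntegral_const, smul_eq_mul,
    measureReal_def, Measure.addHaar_closedBall' _ _ (by positivity : (0 : ℝ) ≤ 2 * R),
    ENNReal.toReal_mul, ENNReal.toReal_ofReal (by positivity), hc, mul_pow]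
  have hRd : R ^ d ≠ 0 := pow_ne_zero _ hR.ne'
  field_simp
  rw [← hd]
  ring

/-- The gradient of a bounded harmonic function vanishes (let `R → ∞` in
`abs_fderiv_apply_le_of_harmonic_bounded`). [cite: GilbargTrudinger2001, Thm 2.10] -/
theorem fderiv_eq_zero_of_harmonic_bounded {η : E → ℝ} (hη : HarmonicOnNhd η univ)
    (hB : ∃ B, ∀ x, |η x| ≤ B) (y : E) : fderiv ℝ η y = 0 := by
  obtain ⟨B, hB⟩ := hB
  obtain ⟨Cθ, hCθ⟩ := (exists_bound_baseBump_derivs (E := E)).1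
  ext a
  rw [show (0 : E →L[ℝ] ℝ) a = 0 from rfl]
  set K := (baseBumpMass E)⁻¹ * Cθ * B * ‖a‖ *
    ((2 : ℝ) ^ Module.finrank ℝ E * (volume (closedBall (0 : E) 1)).toReal) with hK
  have hK0 : 0 ≤ K := by
    have hB0 : 0 ≤ B := (abs_nonneg _).trans (hB 0)
    have hC0 : 0 ≤ Cθ := (norm_nonneg _).trans (hCθ 0)
    have hm0 : 0 < baseBumpMass E := baseBumpMass_pos
    positivity
  have hbound : ∀ R : ℝ, 0 < R → |fderiv ℝ η y a| ≤ K * R⁻¹ := fun R hR =>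
    abs_fderiv_apply_le_of_harmonic_bounded hη hB hCθ hR y a
  by_contra hne
  have ht : 0 < |fderiv ℝ η y a| := abs_pos.2 hne
  set t := |fderiv ℝ η y a| with ht'
  -- take `R = K/t + 1`: then `K R⁻¹ < t`
  have hR : 0 < K / t + 1 := by positivity
  have h := hbound (K / t + 1) hR
  have hlt : K * (K / t + 1)⁻¹ < t := by
    rw [← div_eq_mul_inv, div_lt_iff₀ hR]
    have : t * (K / t + 1) = K + t := by field_simp
    rw [this]
    linarith
  linarith

/-- **Liouville's theorem for bounded harmonic functions** on a finite-dimensional real inner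
product space: a bounded harmonic `η : E → ℝ` is constant. [cite: GilbargTrudinger2001, Thm 2.10] -/
theorem isConst_of_harmonic_bounded {η : E → ℝ} (hη : HarmonicOnNhd η univ)
    (hB : ∃ B, ∀ x, |η x| ≤ B) (x y : E) : η x = η y :=
  is_const_of_fderiv_eq_zero
    ((contDiff_two_of_harmonicOnNhd_univ hη).differentiable (by norm_num))
    (fderiv_eq_zero_of_harmonic_bounded hη hB) x y

/-- **Liouville, vector-valued**: a bounded harmonic map into a real inner product space is
constant (apply the scalar theorem to `⟪v, U⟫` for every `v`; Tsai 1998, p. 48, componentwise on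
`U = (U₁, U₂, U₃)`). [cite: GilbargTrudinger2001, Thm 2.10] -/
theorem isConst_of_harmonic_bounded_inner {F : Type*} [NormedAddCommGroup F]
    [InnerProductSpace ℝ F] {U : E → F} (hU : HarmonicOnNhd U univ) (hB : ∃ B, ∀ x, ‖U x‖ ≤ B)
    (x y : E) : U x = U y := by
  obtain ⟨B, hB⟩ := hB
  refine ext_inner_left ℝ fun v => ?_
  have hη : HarmonicOnNhd ((innerSL ℝ v : F →L[ℝ] ℝ) ∘ U) univ := hU.comp_CLM (innerSL ℝ v)
  have hb : ∀ z, |((innerSL ℝ v : F →L[ℝ] ℝ) ∘ U) z| ≤ ‖v‖ * B := fun z => by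
    simp only [comp_apply, innerSL_apply_apply]
    exact (abs_real_inner_le_norm v (U z)).trans (mul_le_mul_of_nonneg_left (hB z) (norm_nonneg _))
  simpa using isConst_of_harmonic_bounded hη ⟨‖v‖ * B, hb⟩ x y

end BoundedLiouville

/-! ## Tsai 1998, Theorem 1, `q = ∞` -/

section Tsai

/-- **Tsai 1998, Theorem 1, the case `q = ∞`** (p. 31: a weak solution `U` of Leray's profile
system (1.3) in `L^q(ℝ³)`, `q ∈ (3, ∞]`, "must be constant (and hence identically zero if
`q < ∞`)"): for `ν > 0`, `a > 0` and a Leray profile `(U, P)` on `ℝ³` (`IsLerayProfile ν a U P`,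
the tree's pointwise class, contained in Tsai's weak class) with `U` **bounded**, the velocity
`U` is constant.  (Constant `U ≡ c` with `P = −a c·y + const` are indeed profiles; for the
finite-`q` clause see `tsai_selfsimilar`.)  Discharged below: `tsai_selfsimilar_bounded_holds`.
[cite: Tsai1998, Thm 1 (p. 31)] -/
def tsai_selfsimilar_bounded : Prop :=
  ∀ {ν a : ℝ} (_hν : 0 < ν) (_ha : 0 < a) {U : EuclideanSpace ℝ (Fin 3) → EuclideanSpace ℝ (Fin 3)}
    {P : EuclideanSpace ℝ (Fin 3) → ℝ} (_hprof : FluidPDE.IsLerayProfile ν a U P)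
    (_hU : ∃ M : ℝ, ∀ y, ‖U y‖ ≤ M), ∃ c : EuclideanSpace ℝ (Fin 3), ∀ y, U y = c

/-- **Discharge of `tsai_selfsimilar_bounded`** (Tsai 1998, Theorem 1, `q = ∞`), following §5,
p. 48: boundedness gives `|U(y)| ≤ (a/2)|y|` far out; Lemma 3.2 at `q = ∞`
(`tsai1998_lemma32_holds`) gives `|P(y)| ≤ C|y|^N` far out; `U ∈ C^∞`
(`tsai1998_profile_smooth_holds`), `P ∈ C²`; the head pressure is polynomially bounded and
`L`-subharmonic, hence constant (Lemma 5.1, `isConst_of_driftOp_nonneg_of_poly`), hence `ΔU ≡ 0`;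
a bounded harmonic field is constant (`isConst_of_harmonic_bounded_inner`).
[cite: Tsai1998, Thm 1 (p. 31) and §5 (p. 48)] -/
theorem tsai_selfsimilar_bounded_holds : tsai_selfsimilar_bounded := by
  intro ν a hν ha U P hprof hUM
  obtain ⟨M, hM⟩ := hUM
  set M₀ := max M 0 with hM₀
  have hM₀0 : 0 ≤ M₀ := le_max_right _ _
  have hUM₀ : ∀ y, ‖U y‖ ≤ M₀ := fun y => (hM y).trans (le_max_left _ _)
  have hU3 : ContDiff ℝ 3 U := contDiff_infty.1 (tsai1998_profile_smooth_holds hν ha hprof) 3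
  have hP2 : ContDiff ℝ 2 P := hprof.contDiff_two_pressure hU3
  have hU2 : ContDiff ℝ 2 U := hU3.of_le (by norm_num)
  have hUc : Continuous U := hU2.continuous
  -- growth `|U(y)| ≤ (a/2)|y|` for `|y| ≥ 2M₀/a`
  have hUb : ∀ y : EuclideanSpace ℝ (Fin 3), 2 * M₀ / a ≤ ‖y‖ → ‖U y‖ ≤ a / 2 * ‖y‖ := by
    intro y hy
    have : M₀ ≤ a / 2 * ‖y‖ := by
      rw [div_le_iff₀ ha] at hy
      linarith
    exact (hUM₀ y).trans this
  -- `U ∈ L^∞`, so Lemma 3.2 applies with `q = ∞`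
  have hUtop : MemLp U ∞ volume :=
    memLp_top_of_bound hUc.aestronglyMeasurable M₀ (Eventually.of_forall hUM₀)
  obtain ⟨N, C, R, hPR⟩ := tsai1998_lemma32_holds hν ha hprof (q := ∞) le_top hUtop
  obtain ⟨M₁, hM₁0, hM₁⟩ := exists_affine_bound_of_eventually_le hUc hUb
  obtain ⟨C', hC'0, hC'⟩ := exists_poly_bound_of_eventually_le hP2.continuous hPR
  have hgrowth := abs_headPressure_le ha.le (half_pos ha).le hM₁0 hC'0 hM₁ hC'
  have hconst := isConst_of_driftOp_nonneg_of_poly hν (half_pos ha).le (half_lt_self ha)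
    (contDiff_headPressure hU2 hP2) hUc
    (hprof.driftOp_headPressure_nonneg_of_contDiff hν.le hU3 hP2) hUb hgrowth
  have hΔ : ∀ y, (Δ U) y = 0 :=
    hprof.laplacian_eq_zero_of_headPressure_const_of_contDiff hν.ne' hU3 hP2 hconst
  exact ⟨U 0, fun y => isConst_of_harmonic_bounded_inner (harmonicOnNhd_of_laplacian_eq_zero hU2 hΔ)
    ⟨M₀, hUM₀⟩ y 0⟩

/-- The `q = ∞` clause in Tsai's own words — a bounded profile "must be constant" — as a plain
theorem (no hypothesis to thread). [cite: Tsai1998, Thm 1 (p. 31)] -/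
theorem IsLerayProfile.exists_eq_const_of_bounded {ν a : ℝ} (hν : 0 < ν) (ha : 0 < a)
    {U : EuclideanSpace ℝ (Fin 3) → EuclideanSpace ℝ (Fin 3)} {P : EuclideanSpace ℝ (Fin 3) → ℝ}
    (hprof : IsLerayProfile ν a U P) (hU : ∃ M : ℝ, ∀ y, ‖U y‖ ≤ M) :
    ∃ c : EuclideanSpace ℝ (Fin 3), ∀ y, U y = c :=
  tsai_selfsimilar_bounded_holds hν ha hprof hU

end Tsai

end Literature.Analysis.FluidPDE

end
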